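import Mathlib
import HarnessLib

/-!
# LINE (A) `product_plus_one` (crux `MatrixDescartes`, stmt-ValiantsHypothesis-18050, V1) — W-CB §30.5 C5, CLOUD SIDES FROM ONE ENDPOINT:
# the window hypotheses of the cloud branches (C↓)/(C↑) of ✓⧗ `sixthOrderCloudCell_…` / `sixthOrderFullCell_…` follow from the sign of `f` at ONE endpoint

A one-change trinomial `g(x) = b₀ + b₁x^p + b₂x^q` (`0 < p < q`) has exactly one positive root and a definite sign on each side of it; in the product form the
cells use (`b 0 · g`):
* `cloud_bottom_side_of_right_endpoint` — `b₀b₁ < 0`, `b₀b₂ < 0` (isolated BOTTOM sign, T5 `(+,−,−)`/`(−,+,+)`): `b₀·g` is strictly DECREASING on `(0,∞)`, so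
  `0 ≤ b₀·g(v)` gives `0 < b₀·g(x)` for all `0 < x < v` — the (C↓) hypothesis from the RIGHT endpoint;
* `cloud_top_side_of_left_endpoint` — `0 < b₀b₁` (T4 `(+,+,−)`/`(−,−,+)`; the sign of `b₂` is not needed): `x^{−q}·b₀·g` is strictly decreasing, so
  `b₀·g(u) ≤ 0` with `0 < u` gives `b₀·g(x) < 0` for all `x > u` — the (C↑) hypothesis from the LEFT endpoint.
(The exponents are written `p` and `p + r` with `0 < p`, `0 < r`; instantiate `p = d1 − d0`, `r = d2 − d1`.)  Pure one-variable monotonicity (Mathlib only); the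
same role as ✓ `binomial_ne_zero_of_endpoints` for the pole rows.
HONEST FRAMING: bookkeeping helper; nothing about `WronskianBudgetK3` / `OneChangeFloorK3` / 18050 / `MatrixDescartes`; `VP ≠ VNP` is NOT proved.
No definitions, no named facts, no sorry.
-/

set_option linter.dupNamespace false

namespace Summit.ValiantsHypothesis.ValiantsHypothesis.Theorems.LacunarySymmetroidMatrixDescartes

namespace ProductPlusOne

open Set

/-- **(C↓) from the right endpoint.**  `b₀b₁ < 0`, `b₀b₂ < 0`, `0 < x < v`, `0 ≤ b₀·(b₀ + b₁v^p + b₂v^{p+r})` ⇒ `0 < b₀·(b₀ + b₁x^p + b₂x^{p+r})`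
(`0 < p`). [this file's lemma] -/
theorem cloud_bottom_side_of_right_endpoint (b₀ b₁ b₂ : ℝ) {p r : ℕ} (hp : 0 < p) (h01 : b₀ * b₁ < 0) (h02 : b₀ * b₂ < 0)
    {x v : ℝ} (hx : 0 < x) (hxv : x < v) (hv : 0 ≤ b₀ * (b₀ + b₁ * v ^ p + b₂ * v ^ (p + r))) :
    0 < b₀ * (b₀ + b₁ * x ^ p + b₂ * x ^ (p + r)) := by
  have hxp : x ^ p < v ^ p := pow_lt_pow_left₀ hxv hx.le hp.ne'
  have hxq : x ^ (p + r) < v ^ (p + r) := pow_lt_pow_left₀ hxv hx.le (by omega)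
  have h1 : b₀ * b₁ * x ^ p > b₀ * b₁ * v ^ p := mul_lt_mul_of_neg_left hxp h01
  have h2 : b₀ * b₂ * x ^ (p + r) > b₀ * b₂ * v ^ (p + r) := mul_lt_mul_of_neg_left hxq h02
  nlinarith

/-- **(C↑) from the left endpoint.**  `0 < b₀b₁`, `0 < u < x`, `b₀·(b₀ + b₁u^p + b₂u^{p+r}) ≤ 0` ⇒ `b₀·(b₀ + b₁x^p + b₂x^{p+r}) < 0`
(`0 < r`; `x^{p+r}·(b₀g)(u) − u^{p+r}·(b₀g)(x) = b₀²(x^{p+r} − u^{p+r}) + b₀b₁·u^px^p·(x^r − u^r) > 0` — the sign of `b₂` is not even needed). [this file's lemma] -/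
theorem cloud_top_side_of_left_endpoint (b₀ b₁ b₂ : ℝ) {p r : ℕ} (hr : 0 < r) (h01 : 0 < b₀ * b₁)
    {u x : ℝ} (hu : 0 < u) (hux : u < x) (hside : b₀ * (b₀ + b₁ * u ^ p + b₂ * u ^ (p + r)) ≤ 0) :
    b₀ * (b₀ + b₁ * x ^ p + b₂ * x ^ (p + r)) < 0 := by
  have hx : 0 < x := hu.trans hux
  have hur : u ^ r < x ^ r := pow_lt_pow_left₀ hux hu.le hr.ne'
  have huq : u ^ (p + r) < x ^ (p + r) := pow_lt_pow_left₀ hux hu.le (by omega)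
  have hb0 : b₀ ≠ 0 := fun h => by rw [h, zero_mul] at h01; exact lt_irrefl _ h01
  have hb00 : 0 < b₀ ^ 2 := by positivity
  have hupxp : 0 < u ^ p * x ^ p := by positivity
  -- the comparison `x^{p+r}·G(u) − u^{p+r}·G(x) > 0`, `G = b₀·g`
  have key : x ^ (p + r) * (b₀ * (b₀ + b₁ * u ^ p + b₂ * u ^ (p + r))) - u ^ (p + r) * (b₀ * (b₀ + b₁ * x ^ p + b₂ * x ^ (p + r)))
      = b₀ ^ 2 * (x ^ (p + r) - u ^ (p + r)) + b₀ * b₁ * (u ^ p * x ^ p) * (x ^ r - u ^ r) := by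
    rw [pow_add, pow_add]; ring
  have hpos : 0 < x ^ (p + r) * (b₀ * (b₀ + b₁ * u ^ p + b₂ * u ^ (p + r))) - u ^ (p + r) * (b₀ * (b₀ + b₁ * x ^ p + b₂ * x ^ (p + r))) := by
    rw [key]
    have t1 : 0 < b₀ ^ 2 * (x ^ (p + r) - u ^ (p + r)) := mul_pos hb00 (by linarith)
    have t2 : 0 < b₀ * b₁ * (u ^ p * x ^ p) * (x ^ r - u ^ r) := mul_pos (mul_pos h01 hupxp) (by linarith)
    linarith
  have hxq : 0 < x ^ (p + r) := by positivity
  have huq' : 0 < u ^ (p + r) := by positivity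
  -- `x^{p+r}·G(u) ≤ 0`, hence `u^{p+r}·G(x) < 0`, hence `G(x) < 0`
  have h1 : x ^ (p + r) * (b₀ * (b₀ + b₁ * u ^ p + b₂ * u ^ (p + r))) ≤ 0 := mul_nonpos_of_nonneg_of_nonpos hxq.le hside
  have h2 : u ^ (p + r) * (b₀ * (b₀ + b₁ * x ^ p + b₂ * x ^ (p + r))) < 0 := by linarith
  by_contra h
  exact absurd h2 (not_lt.mpr (mul_nonneg huq'.le (not_lt.mp h)))

/-- **(C↓) on a window** (LINE spelling: `p = d 1 − d 0`, `p + r = d 2 − d 0`): from `0 ≤ b₀·g(v)` to `∀ x ∈ (u,v), 0 < b₀·g(x)` (`0 ≤ u`). [this file's lemma] -/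
theorem cloud_bottom_side_on_window (d : Fin 3 → ℕ) (hd : StrictMono d) (b : Fin 3 → ℝ) {u v : ℝ} (hu : 0 ≤ u)
    (h01 : b 0 * b 1 < 0) (h02 : b 0 * b 2 < 0) (hv : 0 ≤ b 0 * (b 0 + b 1 * v ^ (d 1 - d 0) + b 2 * v ^ (d 2 - d 0))) :
    ∀ x ∈ Ioo u v, 0 < b 0 * (b 0 + b 1 * x ^ (d 1 - d 0) + b 2 * x ^ (d 2 - d 0)) := by
  intro x hx
  have h01' : d 0 < d 1 := hd (by decide)
  have h12' : d 1 < d 2 := hd (by decide)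
  have hq : d 2 - d 0 = (d 1 - d 0) + (d 2 - d 1) := by omega
  rw [hq] at hv ⊢
  exact cloud_bottom_side_of_right_endpoint (b 0) (b 1) (b 2) (by omega) h01 h02 (hu.trans_lt hx.1) hx.2 hv

/-- **(C↑) on a window** (LINE spelling): from `b₀·g(u) ≤ 0`, `0 < u` to `∀ x ∈ (u,v), b₀·g(x) < 0`. [this file's lemma] -/
theorem cloud_top_side_on_window (d : Fin 3 → ℕ) (hd : StrictMono d) (b : Fin 3 → ℝ) {u v : ℝ} (hu : 0 < u)
    (h01 : 0 < b 0 * b 1) (hside : b 0 * (b 0 + b 1 * u ^ (d 1 - d 0) + b 2 * u ^ (d 2 - d 0)) ≤ 0) :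
    ∀ x ∈ Ioo u v, b 0 * (b 0 + b 1 * x ^ (d 1 - d 0) + b 2 * x ^ (d 2 - d 0)) < 0 := by
  intro x hx
  have h01' : d 0 < d 1 := hd (by decide)
  have h12' : d 1 < d 2 := hd (by decide)
  have hq : d 2 - d 0 = (d 1 - d 0) + (d 2 - d 1) := by omega
  rw [hq] at hside ⊢
  exact cloud_top_side_of_left_endpoint (b 0) (b 1) (b 2) (by omega) h01 hu hx.1 hside

end ProductPlusOne

end Summit.ValiantsHypothesis.ValiantsHypothesis.Theorems.LacunarySymmetroidMatrixDescartes
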